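import Literature.AlgebraicGeometry.HodgeTheory.UnitaryHodgeGroupPowersHodgeClasses
import HarnessLib

/-!
# The unitary socket discharged on Ribet type `(m,1)`: the tree's Lie theorem `Lie Hg = 𝔲_K` IS the hypothesis `hU` (Ribet 1983 Thm. 3; Moonen–Zarhin 1999 (2.3); Deligne LNM 900 I Prop. 3.4)

Family `hodge`, layer `Literature/AlgebraicGeometry/HodgeTheory`; cell `pub-hodgeav-hg6` (row 2 «base of HC ladder», TABLE X
row 8; nothing here proves HC, HC_AV or HC_CM). UNCONDITIONAL; theorems only, no definition, no named fact, no `sorry`;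
nothing of R9 (`RibetTypeOnePowersHodgeClasses`) or L11 is restated. TEMPLATE for the (4,2) discharge: when
`top_or_radical_two_four` (eng-5 g5 V5) lands, the same ten lines with the socket U1d+U1c+U1b+U1 give hU for (4,2) and L13's
`census_row8_unitaryGeneral` discharges. Here the tree's `(m,1)` Lie theorem `UnitaryTheta.mem_spanC_of_commute_of_skew` is
applied to the admissible algebra `𝔤 = Lie Hg(H)` itself (`commutator_mem_hodgeLie`, `mem_hodgeLieC_of_forall_piece`,
`commute_of_mem_hodgeLie`, `form_apply_add_eq_zero_of_mem_hodgeLie`) and read through `hodgeLieC_eq_spanC`; the result is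
literally the hypothesis `hU` of `UnitaryHodgeGroupSlotsHodgeClasses` / `…PowersHodgeClasses` / L13: §1
`UnitaryTheta.mem_hodgeLieC_of_commute_of_skew` (abstract), §2 `hodgeLieC_typeOne_of_eigenMultiplicity_eq_one` (geometric:
`φ ≫ φ = -d`, `finrank_ℚ End⁰(A) = 2`, multiplicity `1` at `± i√d`, `dim A ≥ 3`, any polarization `ψ`; fed to
`AbelianVariety.isDivisorGenerated_powSucc_of_hodgeLieC_unitary` it re-derives R9 — checked in a scratch `example`, not landed).

## References

* [Ribet1983] K. A. Ribet, Amer. J. Math. 105 (1983), Thm. 0 and Thm. 3.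
* [MoonenZarhin1999LowDim] B. Moonen, Yu. Zarhin, Math. Ann. 315 (1999) = arXiv:math/9901113, §1 (1.8), §2 (2.3).
* [Deligne1982HodgeCycles] P. Deligne, LNM 900 (1982), I §3 Prop. 3.4.
* [Gordon1997] B. B. Gordon, arXiv:alg-geom/9709030, Thm. 6.3 (3), §6 pp. 18–19.
-/

noncomputable section

open scoped TensorProduct
open CategoryTheory Module


namespace Literature.AlgebraicGeometry.Motives.HodgeStructure

universe u

variable {V : Type u} [AddCommGroup V] [Module ℚ V] {n : ℤ}

/-- **Ribet type `(m,1)`: every `φ_ℂ`-commuting `ψ_ℂ`-skew operator lies in `Lie Hg(H) ⊗ ℂ`** (MZ99 (2.3) «`Hg(X) =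
U_F(V, ψ)`»; Ribet Thm. 3) — `UnitaryTheta.mem_spanC_of_commute_of_skew` for `𝔤 = Lie Hg(H)`: the socket's `hU`, discharged.
[cite: MoonenZarhin1999LowDim, §2 (2.3)] [cite: Ribet1983, Thm. 3] [cite: Deligne1982HodgeCycles, I §3 Prop. 3.4] -/
theorem UnitaryTheta.mem_hodgeLieC_of_commute_of_skew [Module.Finite ℚ V] [HodgeTensorFacts.{u, u}]
    (H : HodgeStructure V n) (hn : n = 1) (heff : H.IsEffective) (ψ : H.Polarization) {φ : Module.End ℚ V}
    (hφE : φ ∈ H.endAlg) {d : ℚ} (hd : 0 < d) (hφ2 : φ * φ = -(d • 1))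
    (hE : ∀ a ∈ H.endAlg, ∃ x y : ℚ, a = x • 1 + y • φ) {μ : ℂ} (hμ : μ ^ 2 = -(d : ℂ))
    (h1 : Module.finrank ℂ ↥(Module.End.eigenspace (φ.baseChange ℂ) μ ⊓ H.piece 0 1) = 1)
    (h2 : 2 ≤ Module.finrank ℂ ↥(Module.End.eigenspace (φ.baseChange ℂ) μ ⊓ H.piece 1 0)) :
    ∀ Y : Module.End ℂ (ℂ ⊗[ℚ] V), Y * φ.baseChange ℂ = φ.baseChange ℂ * Y →
      (∀ x y, ψ.form.baseChange ℂ (Y x) y + ψ.form.baseChange ℂ x (Y y) = 0) → Y ∈ H.hodgeLieC := fun Y hYφ hYskew => by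
  obtain ⟨Θ, hΘ⟩ := exists_hodgeTheta H
  have hΘ𝔤 : Θ ∈ spanC H.hodgeLie := (hodgeLieC_eq_spanC H) ▸ H.mem_hodgeLieC_of_forall_piece hΘ
  rw [hodgeLieC_eq_spanC]
  exact UnitaryTheta.mem_spanC_of_commute_of_skew H hn heff ψ hφE hd hφ2 hE hμ h1 h2 H.hodgeLie
    (fun X hX X' hX' => H.commutator_mem_hodgeLie hX hX') hΘ hΘ𝔤 (fun X hX a => H.commute_of_mem_hodgeLie hX a)
    (fun X hX => form_apply_add_eq_zero_of_mem_hodgeLie ψ hX) hYφ hYskew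

end Literature.AlgebraicGeometry.Motives.HodgeStructure


namespace Literature.AlgebraicGeometry.HodgeTheory

open Literature.AlgebraicTopology.SingularHomology
open Literature.AlgebraicGeometry.Motives (IsSmoothProjective AbelianVariety bettiCohomology
  ofRatClassBaseChange ofRatClassBaseChange_tmul HodgeTensorFacts hodgeTensorFacts_holds)
open Literature.Barriers.HodgeConjecture
open Literature.AlgebraicGeometry.Motives.HodgeStructure
open Literature.AlgebraicGeometry.ComplexMultiplication (bettiRep_of)

variable {A : AbelianVariety ℂ}

/-- **`hU` for an abelian variety of Ribet type `(dim A − 1, 1)`** (`φ ≫ φ = -d`, `d > 0`, `finrank_ℚ End⁰(A) = 2`,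
multiplicity `1` at `i√d` or at `-i√d`, `dim A ≥ 3`, ANY polarization `ψ` of `H¹(A(ℂ); ℚ)`): every `(φ^*)_ℂ`-commuting
`ψ_ℂ`-skew operator lies in `Lie Hg(H¹(A)) ⊗ ℂ` (`μ = ∓ i√d` makes `W_μ ∩ H^{0,1}` the line; §1 + the multiplicity dictionary).
[cite: Ribet1983, Thm. 3] [cite: Gordon1997, §6 (pp. 18–19)] [cite: MoonenZarhin1999LowDim, §2 (2.3)] -/
theorem hodgeLieC_typeOne_of_eigenMultiplicity_eq_one [HodgeTensorFacts.{0, 0}] (φ : A ⟶ A) {d : ℕ} (hd : 0 < d)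
    (hφ : φ ≫ φ = -(d • 𝟙 A)) (hE2 : Module.finrank ℚ A.endAlgebra = 2)
    (h1 : eigenMultiplicity A φ (Complex.I * (Real.sqrt d : ℂ)) = 1 ∨
      eigenMultiplicity A φ (-(Complex.I * (Real.sqrt d : ℂ))) = 1)
    (hdim : 3 ≤ A.dim) (hHD : exists_isReal_hodgeModel) (hI : hodgePQ_independent_of_hodgeModel)
    (ψ : (BettiUniverse.hodge hHD (AbelianVariety.isSmoothProjective_holds (A := A)) 1).Polarization) :
    ∀ Y : Module.End ℂ (ℂ ⊗[ℚ] bettiCohomology A.X 1),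
      Y * ((bettiCohomology.map φ.hom.hom.hom 1).hom).baseChange ℂ =
          ((bettiCohomology.map φ.hom.hom.hom 1).hom).baseChange ℂ * Y →
        (∀ x y, ψ.form.baseChange ℂ (Y x) y + ψ.form.baseChange ℂ x (Y y) = 0) →
          Y ∈ (BettiUniverse.hodge hHD (AbelianVariety.isSmoothProjective_holds (A := A)) 1).hodgeLieC := by
  classical
  haveI : Module.Finite ℚ (bettiCohomology A.X 1) := finite_bettiCohomology_one A
  have heff := BettiUniverse.hodge_isEffective hHD (AbelianVariety.isSmoothProjective_holds (A := A)) 1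
  set φQ : Module.End ℚ (bettiCohomology A.X 1) := (bettiCohomology.map φ.hom.hom.hom 1).hom with hφQ
  have hφE : φQ ∈ (BettiUniverse.hodge hHD (AbelianVariety.isSmoothProjective_holds (A := A)) 1).endAlg := by
    have h := unop_bettiRep_mem_endAlg hHD hI (AbelianVariety.endAlgebra.of A φ)
    rwa [bettiRep_of, MulOpposite.unop_op] at h
  have hφ2 : φQ * φQ = -((d : ℚ) • 1) := bettiMapHom_mul_self hφ
  have hdQ : (0 : ℚ) < d := Nat.cast_pos.2 hd
  have hE := exists_eq_smul_one_add_smul_bettiMapHom hHD hI hd hφ hE2 (by omega)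
  -- the eigenvalue `μ` with `n''(μ) = 1`, `n'(μ) ≥ 2`
  have hsum := eigenMultiplicity_add_eigenMultiplicity_neg_eq_dim A φ hd hφ
  have hμ₀ : (Complex.I * (Real.sqrt d : ℂ)) ^ 2 = -((d : ℚ) : ℂ) := by
    rw [mul_pow, Complex.I_sq, ← Complex.ofReal_pow, Real.sq_sqrt (Nat.cast_nonneg d), Complex.ofReal_natCast,
      Rat.cast_natCast, neg_one_mul]
  have hconj₀ : starRingEnd ℂ (Complex.I * (Real.sqrt d : ℂ)) = -(Complex.I * (Real.sqrt d : ℂ)) := by simp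
  obtain ⟨μ, hμ, hm1, hm2⟩ : ∃ μ : ℂ, μ ^ 2 = -((d : ℚ) : ℂ) ∧
      eigenMultiplicity A φ (starRingEnd ℂ μ) = 1 ∧ 2 ≤ eigenMultiplicity A φ μ := by
    rcases h1 with h | h
    · exact ⟨-(Complex.I * (Real.sqrt d : ℂ)), by rw [neg_sq, hμ₀], by rw [map_neg, hconj₀, neg_neg, h], by omega⟩
    · exact ⟨Complex.I * (Real.sqrt d : ℂ), hμ₀, by rw [hconj₀, h], by omega⟩
  have h1' : Module.finrank ℂ ↥(Module.End.eigenspace (φQ.baseChange ℂ) μ ⊓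
      (BettiUniverse.hodge hHD (AbelianVariety.isSmoothProjective_holds (A := A)) 1).piece 0 1) = 1 := by
    rw [hφQ, finrank_eigenspace_inf_piece_zeroOne_eq_eigenMultiplicity_conj hHD hI φ μ, hm1]
  have h2' : 2 ≤ Module.finrank ℂ ↥(Module.End.eigenspace (φQ.baseChange ℂ) μ ⊓
      (BettiUniverse.hodge hHD (AbelianVariety.isSmoothProjective_holds (A := A)) 1).piece 1 0) := by
    rw [hφQ, finrank_eigenspace_inf_piece_oneZero_eq_eigenMultiplicity hHD hI φ μ]; exact hm2
  exact UnitaryTheta.mem_hodgeLieC_of_commute_of_skew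
    (BettiUniverse.hodge hHD (AbelianVariety.isSmoothProjective_holds (A := A)) 1) Nat.cast_one heff ψ hφE hdQ hφ2 hE
    hμ h1' h2'

end Literature.AlgebraicGeometry.HodgeTheory

end
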